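import Mathlib.RingTheory.PowerSeries.Basic
import Mathlib.Analysis.SpecialFunctions.Pow.Real
import Literature.AlgebraicGeometry.Motives.ZetaFunction
import Literature.AlgebraicGeometry.Motives.FrobeniusTrace
import Literature.AlgebraicGeometry.Motives.Varieties
import Literature.AlgebraicGeometry.Motives.AlgPoints
import Literature.AlgebraicGeometry.Motives.GaloisRealization
import HarnessLib

-- provenance: harness21/H21/H21/Statements/RH/WeilConjectures.lean @ 315230b (interim HEAD d8f2665); M5 mechanical rewrite
/-!
# The Weil conjectures (family RH, statement rh.S37; trunk MotiveL, OUTLINE §3)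

For a smooth projective variety `X` of dimension `n` over a finite field `k = 𝔽_q`
(`q = Nat.card k`), with zeta function `Z(X, T) = exp (∑_{m ≥ 1} #X(𝔽_{q^m}) Tᵐ / m) ∈ ℚ⟦T⟧`
(accepted C3 `Literature.AlgebraicGeometry.Motives.zetaSeries`), we state:

* **rh.S37** (Weil conjectures, Deligne's theorem): `Z(X, T) = ∏ᵢ Pᵢ(T)^{(-1)^{i+1}}` with
  `Pᵢ ∈ ℤ[T]`, `P₀ = 1 - T`, `P_{2n} = 1 - qⁿT`, and all reciprocal roots of `Pᵢ` of absolute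
  value `q^{i/2}` — `Literature.NumberTheory.LFunctions.exists_isWeilFactorization`, phrased with the accepted predicate
  `Literature.AlgebraicGeometry.Motives.IsWeilFactorization`;
* Dwork's rationality theorem for an arbitrary `k`-scheme of finite type —
  `Literature.NumberTheory.LFunctions.exists_polynomial_mul_zetaSeries_eq`;
* Grothendieck's functional equation — `Literature.NumberTheory.LFunctions.hasFunctionalEquation_zetaSeries`, phrased with
  the accepted `Literature.AlgebraicGeometry.Motives.HasFunctionalEquation`, `χ = ∑ (-1)ⁱ deg Pᵢ`;
* the Hasse–Weil bound for curves — `Literature.NumberTheory.LFunctions.abs_pointCount_sub_le_of_curve`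
  (`|N_m - qᵐ - 1| ≤ 2g q^{m/2}`, `2g = deg P₁`), in `ℝ`;
* the cohomological form `Z(X, T) ∏_{i even} det(1 - TF | Hⁱ) = ∏_{i odd} det(1 - TF | Hⁱ)`
  for a Galois Weil cohomology satisfying the Lefschetz trace formula —
  now only upstream, `Literature.AlgebraicGeometry.Motives.GaloisWeilCohomology.zetaSeries_mul_prod_frobCharPoly`
  (`FrobeniusTrace.lean`; the local restatement was removed in the M5 migration);
* the statement of Deligne's *Weil I* main theorem for a given Galois Weil cohomology theory
  `E`, as a `Prop` — `Literature.NumberTheory.LFunctions.DeligneWeilIStatement`.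

## Sources

* A. Weil, *Sur les courbes algébriques et les variétés qui s'en déduisent* (1948).
* A. Weil, *Numbers of solutions of equations in finite fields*, Bull. AMS 55 (1949), p. 507.
* B. Dwork, *On the rationality of the zeta function of an algebraic variety*, Amer. J. Math.
  82 (1960), Thm. 1.
* A. Grothendieck, *Formule de Lefschetz et rationalité des fonctions L*, Sém. Bourbaki 279
  (1964/65).
* P. Deligne, *La conjecture de Weil. I*, Publ. Math. IHÉS 43 (1974), Thm. (1.6).
* R. Hartshorne, *Algebraic Geometry*, Appendix C, Thms. 1.1–1.4.

## Design notes

* Mathlib has `RiemannHypothesis` (for `ζ(s)`, `Mathlib/NumberTheory/LSeries/RiemannZeta.lean`)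
  but no zeta function of a variety over a finite field, no Weil conjectures and no Hasse–Weil
  bound (searched `Weil conjecture`, `HasseWeil`, `zeta.*variety`); everything here is built on
  the accepted H21 preludes `MotiveL.ZetaFunction` (C3) and `MotiveL.FrobeniusTrace` (C4).
* rh.S37 is a *known theorem* (Deligne 1974), hence an honest `theorem … := by sorry`.
  `DeligneWeilIStatement E` is a `def … : Prop` because it is a property of the abstract
  cohomology theory `E` (a theorem only for `ℓ`-adic étale cohomology).
* Dwork rationality carries `[LocallyOfFiniteType X.hom] [QuasiCompact X.hom]`: without them
  `pointCount` is the junk value `0` of `Nat.card` on infinite types (C3 design notes) and the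
  statement would be about a meaningless series.
* The curve bound is stated in `ℝ` with real subtraction and `Real.rpow` for `q^{m/2}`; no
  `ℕ`-subtraction occurs.
-/

universe u v

open CategoryTheory AlgebraicGeometry Polynomial

noncomputable section

namespace Literature.NumberTheory.LFunctions

section RH

variable {k : Type u} [Field k] [Finite k]

/-! ### rh.S37: the Weil conjectures -/

/-- **rh.S37** (Weil conjectures / Riemann hypothesis over finite fields; Weil 1949, p. 507;
Dwork 1960; Grothendieck, Sém. Bourbaki 279 (1964/65); Deligne, *Weil I*, Publ. Math. IHÉS 43
(1974), Thm. (1.6); Hartshorne, App. C, Thms. 1.1–1.3). For `X` smooth projective of dimension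
`n` over the finite field `k` with `q` elements there are polynomials
`P₀, …, P_{2n} ∈ ℤ[T]` with `Pᵢ(0) = 1`, `P₀ = 1 - T`, `P_{2n} = 1 - qⁿ T`,
`Z(X, T) = P₁ P₃ ⋯ P_{2n-1} / (P₀ P₂ ⋯ P_{2n})`, and such that every reciprocal root of `Pᵢ` has
complex absolute value `q^{i/2}` (equivalently every complex root `z` of `Pᵢ` has
`|z| = q^{-i/2}`). Known theorem (curves: Weil 1948; general case: Deligne 1974). [cite: Deligne1974, Thm. (1.6)] [cite: Weil1948, curves] -/
def exists_isWeilFactorization : Prop :=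
  ∀ {n : ℕ} {X : Literature.AlgebraicGeometry.Motives.SchemeOver k}, Literature.AlgebraicGeometry.Motives.IsSmoothProjective n X →
    ∃ P : Fin (2 * n + 1) → ℤ[X], Literature.AlgebraicGeometry.Motives.IsWeilFactorization (Nat.card k) n (Literature.AlgebraicGeometry.Motives.zetaSeries X) P

/-- **rh.S37** (rationality of the zeta function; Dwork, Amer. J. Math. 82 (1960), Thm. 1;
Grothendieck, Sém. Bourbaki 279 (1964/65), Cor. 5.2). For any scheme `X` of finite type over the
finite field `k`, `Z(X, T) ∈ ℚ⟦T⟧` is (the expansion of) a rational function: there are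
`p, q ∈ ℚ[T]`, `q ≠ 0`, with `Z(X, T) · q(T) = p(T)`. The finite-type hypotheses are required:
without them `pointCount X m` is the junk value `0` (see `Literature.AlgebraicGeometry.Motives.pointCount`). [cite: Dwork1960, Thm. 1] -/
def exists_polynomial_mul_zetaSeries_eq : Prop :=
  ∀ (X : Literature.AlgebraicGeometry.Motives.SchemeOver k) [LocallyOfFiniteType X.hom] [QuasiCompact X.hom],
    ∃ p q : ℚ[X], q ≠ 0 ∧ Literature.AlgebraicGeometry.Motives.zetaSeries X * (q : PowerSeries ℚ) = (p : PowerSeries ℚ)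

/-- **rh.S37** (functional equation of the zeta function: Grothendieck's theorem, via Poincaré
duality in `ℓ`-adic cohomology — Deligne, *Weil I* (1974), (2.6), pp. 281–282, "la formulation de
Grothendieck de l'équation fonctionnelle des fonctions Z"; Hartshorne, App. C, (1.2), (1.4) and
Thm. 4.4; Milne, *Étale cohomology*, VI Thm. 12.6. Grothendieck's own Sém. Bourbaki 279 (1964/65)
proves the trace formula and rationality, Thm. 5.1 / Cor. 5.2, and does not state the functional
equation). For `X` smooth projective of dimension `n` over `𝔽_q` and any
Weil factorization `(Pᵢ)` of `Z(X, T)`, `Z(1/(qⁿT)) = ± q^{nχ/2} T^χ Z(T)` with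
`χ = ∑ᵢ (-1)ⁱ deg Pᵢ` the Euler characteristic (`= ∑ (-1)ⁱ bᵢ`, the self-intersection of the
diagonal; Hartshorne (1.4)), in the cross-multiplied form
`Literature.AlgebraicGeometry.Motives.HasFunctionalEquation`. Reduced in this tree to the existence
of `ℓ`-adic cohomology as a Galois Weil cohomology theory with the Lefschetz trace formula
(`hasFunctionalEquation_zetaSeries_of_exists_galoisWeilCohomology`,
`WeilConjecturesFunctionalEquationLowDimProofs.lean`); the cases `n ≤ 1` hold unconditionally
(`hasFunctionalEquation_zetaSeries_of_isWeilFactorization_zero`, `…_one`).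
[cite: Hartshorne1977, App. C (1.2), (1.4), Thm. 4.4] [cite: Deligne1974, (2.6)]
[cite: Milne2025, VI Thm. 12.6] -/
def hasFunctionalEquation_zetaSeries : Prop :=
  ∀ {n : ℕ} {X : Literature.AlgebraicGeometry.Motives.SchemeOver k}, Literature.AlgebraicGeometry.Motives.IsSmoothProjective n X → ∀ {P : Fin (2 * n + 1) → ℤ[X]}, Literature.AlgebraicGeometry.Motives.IsWeilFactorization (Nat.card k) n (Literature.AlgebraicGeometry.Motives.zetaSeries X) P →
    Literature.AlgebraicGeometry.Motives.HasFunctionalEquation (Nat.card k) n (Literature.AlgebraicGeometry.Motives.zetaSeries X)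
      (∑ i : Fin (2 * n + 1), (-1 : ℤ) ^ (i : ℕ) * ((P i).natDegree : ℤ))

/-- **rh.S37** (Hasse–Weil bound for curves; Weil, *Sur les courbes algébriques et les variétés
qui s'en déduisent* (1948); Hartshorne, App. C, Ex. 1.4 / V Ex. 1.10). For `X` a smooth
projective curve over `𝔽_q` with Weil factorization `Z(X, T) = P₁(T) / ((1 - T)(1 - qT))`,
`deg P₁ = 2g`, one has `|#X(𝔽_{q^m}) - qᵐ - 1| ≤ 2g · q^{m/2}` for every `m ≥ 1`. We assume
`0 < m`: for `m = 0`, `pointCount X 0 = Nat.card X(k̄)` is the junk value `0` and the inequality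
would fail for `X = ℙ¹` (`g = 0`). Stated in `ℝ`: no natural-number subtraction. [cite: Weil1948] -/
def abs_pointCount_sub_le_of_curve : Prop :=
  ∀ {X : Literature.AlgebraicGeometry.Motives.SchemeOver k}, Literature.AlgebraicGeometry.Motives.IsSmoothProjective 1 X → ∀ {P : Fin (2 * 1 + 1) → ℤ[X]}, Literature.AlgebraicGeometry.Motives.IsWeilFactorization (Nat.card k) 1 (Literature.AlgebraicGeometry.Motives.zetaSeries X) P → ∀ {m : ℕ}, 0 < m →
    |(Literature.AlgebraicGeometry.Motives.pointCount X m : ℝ) - (Nat.card k : ℝ) ^ m - 1| ≤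
      (P 1).natDegree * (Nat.card k : ℝ) ^ ((m : ℝ) / 2)

/-! ### Cohomological form -/

section Cohomological

variable {K : Type v} [Field K] [CharZero K] {χ : Field.absoluteGaloisGroup k →* Kˣ}

/- **rh.S37**, cohomological interpretation of the zeta function (Grothendieck, Sém. Bourbaki
279 (1964/65), Cor. 5.2; Deligne, *Weil I* (1974), (1.5.4)):
`Z(X, T) · ∏_{i even} det(1 - T·F | Hⁱ(X)) = ∏_{i odd} det(1 - T·F | Hⁱ(X))` for a Galois Weil
cohomology theory satisfying the Lefschetz trace formula. The former verbatim restatement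
`zetaSeries_mul_prod_frobCharPoly'` of the prelude result
`Literature.AlgebraicGeometry.Motives.GaloisWeilCohomology.zetaSeries_mul_prod_frobCharPoly`
(`Literature/AlgebraicGeometry/Motives/FrobeniusTrace.lean`) was removed in the M5 migration
(D-0014: no restatement of an as yet unproved upstream result); this clause of **rh.S37** lives
there. -/

/-- **rh.S37** (Deligne's *Weil I* main theorem, as a property of a Galois Weil cohomology
theory `E` over the finite field `k`; Deligne, Publ. Math. IHÉS 43 (1974), Thm. (1.6);
Katz–Messing, Invent. Math. 23 (1974)). For every smooth projective `X` of dimension `n` over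
`k` and every `0 ≤ i ≤ 2n`, `det(1 - T·F | Hⁱ(X))` has coefficients in `ℤ` (independent of the
theory) and all its reciprocal roots have complex absolute value `q^{i/2}`
(`E.WeilRiemannHypothesisFor X n`). This is a `Prop`-valued definition: it is a theorem for
`ℓ`-adic étale cohomology (`ℓ ≠ char k`), not for an arbitrary `E`. [folklore] -/
def DeligneWeilIStatement (E : Literature.AlgebraicGeometry.Motives.GaloisWeilCohomology k K χ) : Prop :=
  ∀ ⦃n : ℕ⦄ ⦃X : Literature.AlgebraicGeometry.Motives.SchemeOver k⦄, Literature.AlgebraicGeometry.Motives.IsSmoothProjective n X → E.WeilRiemannHypothesisFor X n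

end Cohomological

end RH

end Literature.NumberTheory.LFunctions

end
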